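import Literature.IUT.LogVolume.TensorPacketShellHull
import Literature.IUT.LogVolume.TensorPacketContentVolume
import Literature.IUT.LogVolume.PacketDifferent
import Literature.IUT.LogVolume.IntegerRingFinite
import HarnessLib

/-!
# The log-shell lattice at a TAME packet: `log_p(R_I^×) = (⊗_i π_i)·R_I`, `log μ̄(log_p(R_I^×)) = b_I·log p + log μ̄(R_I)`,
# hull defect `δ_Λ = −log μ̄(R_I)`; and `−d_{I∖*}·log p ≤ log μ̄(R_I) ≤ 0` at every packet
# ([IUTchIV] Prop. 1.1, Prop. 1.2 (i); Dupuy–Hilado §4.12)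

abc-iut cell, prover seat abc-iut-w5-d082 (item XXVIIc-window of `HOME/skel/FORK-REAL-MODEL.md` §4), sequel to
`TensorPacketShellHull` (`H := log μ̄(hull(log_p(R_I^×))) = Σ_i log‖z_i^max‖`, tame: `= b_I·log p`) and
`TensorPacketContentVolume` (the volume-form window `[log‖g‖ + δ_Λ, log‖g_{i₀}‖ + δ_Λ + {d_I + 1 + 4|I*|/p}·log p]` for the
hull of an (Ind2)-orbit, `δ_Λ := H − log μ̄(log_p(R_I^×))`). HERE the remaining packet invariant `δ_Λ` is evaluated at TAME
packets (`p > 2`, every `e_i ≤ p − 2`, where [IUTchIV] Prop. 1.2 (i) reads `log_p(R_i^×) = 𝔪_i`) and bracketed everywhere: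

* every packet: `log μ̄(R_I) ≤ 0` (`R_I ⊆ (R_I)^∼`) and **`−(d_I − d_*)·log p ≤ log μ̄(R_I)`** for every slot `*`
  ([IUTchIV] Prop. 1.1 `p^{d_{I*}}·(R_I)^∼ ⊆ R_I`, abc-iut-S5's `purePacket_mul_mem_integerPacket`, read in volumes);
* tame: the chosen uniformizers `π_i` realise `p^{−b_I}` AND `p^{a_I}` (`a_i = 1/e_i = −b_i`), so
  **`log_p(R_I^×) = (⊗_i π_i)·R_I`** (`coe_logPacket_eq_purePacket_smul_integerPacket_of_tame`; both inclusions are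
  abc-iut-S6's transport lemmas of Prop. 1.2 (i)), **`log μ̄(log_p(R_I^×)) = b_I·log p + log μ̄(R_I)`** and
  **`δ_Λ = −log μ̄(R_I) ∈ [0, (d_I − d_*)·log p]`** — the hull defect of the log-shell lattice IS the normalisation
  defect of `R_I = ⊗_{ℤ_p} R_i` in `(R_I)^∼`;
* tame volume-form window (`packetLogμ_packetHull_orbit_window_of_tame`): for a bounded region `M` with
  `ι_{i₁}(g_{i₁})·(R_I)^∼ ⊆ M ⊆ ⋃_i ι_i(g_i)·(R_I)^∼`,
  `log‖g_{i₁}‖ − log μ̄(R_I) ≤ log μ̄(hull(⋃_γ γ·M)) ≤ log‖g_{i₀}‖ − log μ̄(R_I) + {d_I + 1}·log p` (all slots tame: `I* = ∅`);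
  and the exact value `−m·log p + b_I·log p` for the content `m` (`exists_packetLogμ_packetHull_orbit_eq_of_tame`).

[cite: Mochizuki2012, IUTchIV Prop. 1.1 p. 9, Prop. 1.2 (i) p. 10] [cite: DupuyHilado2025, §4.12] Classical; (Ind2)/the
hull are the tree's typings of disputed-corpus constructions [claim: Mochizuki2012, status: disputed]; nothing here
takes a side on [IUTchIII] Cor. 3.12. PROOF-ONLY file: no definitions, no named `Prop` facts.
-/

noncomputable section

open Set Module
open scoped Pointwise TensorProduct NormedField

namespace Literature.IUT.LogVolume

variable (p : ℕ) [Fact p.Prime]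
variable {I : Type} [Fintype I] [DecidableEq I] [Nonempty I]
variable (k : I → Type) [∀ i, NontriviallyNormedField (k i)] [∀ i, NormedAlgebra ℚ_[p] (k i)]
  [∀ i, IsUltrametricDist (k i)] [∀ i, ProperSpace (k i)]

/-! ## Every packet: `−(d_I − d_*)·log p ≤ log μ̄(R_I) ≤ 0` -/

/-- `log μ̄(R_I) ≤ 0` (`R_I ⊆ (R_I)^∼`, `log μ̄((R_I)^∼) = 0`). [cite: Mochizuki2012, IUTchIV Prop. 1.1 p. 9] -/
theorem packetLogμ_integerPacket_nonpos : packetLogμ p k (integerPacket p k : Set (PacketAlgebra p k)) ≤ 0 := by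
  rw [← packetLogμ_normalizedPacket p k]
  exact packetLogμ_mono p k (packetAdm_integerPacket p k) (packetAdm_normalizedPacket p k)
    (integerPacket_le_normalizedPacket p k)

/-- **`−(d_I − d_*)·log p ≤ log μ̄(R_I)`** for every slot `*`: with generators `δ_i` of the differents (`i ≠ *`) and
`δ_* = 1`, `(⊗δ_i)·(R_I)^∼ ⊆ R_I` ([IUTchIV] Prop. 1.1) and `log μ̄((⊗δ_i)·(R_I)^∼) = Σ_{i≠*} log‖δ_i‖ = −(d_I − d_*)·log p`.
[cite: Mochizuki2012, IUTchIV Prop. 1.1 p. 9] -/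
theorem packetLogμ_integerPacket_ge (star : I) :
    -((dSum p k - differentOrd p (k star)) * Real.log p) ≤
      packetLogμ p k (integerPacket p k : Set (PacketAlgebra p k)) := by
  have hp0 : (0 : ℝ) < p := by exact_mod_cast (Fact.out : p.Prime).pos
  -- generators of the differents off `*`, `1` at `*`
  have hgen := fun i => exists_different_eq_span p (k i)
  choose g hg using hgen
  let δ : Π i, Valued.integer (k i) := Function.update g star 1
  have hδstar : δ star = 1 := Function.update_self ..
  have hδne : ∀ i, i ≠ star → δ i = g i := fun i hi => Function.update_of_ne hi ..
  have hg0 : ∀ i, g i ≠ 0 := fun i h0 => by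
    apply different_ne_bot p (k i)
    rw [hg i, h0, Ideal.span_singleton_eq_bot]
  have hδ0 : ∀ i, (δ i : k i) ≠ 0 := fun i => by
    by_cases hi : i = star
    · subst hi; rw [hδstar, OneMemClass.coe_one]; exact one_ne_zero
    · rw [hδne i hi]; exact_mod_cast hg0 i
  -- the inclusion `(⊗δ)·(R_I)^∼ ⊆ R_I`
  have hsub : purePacket p k (fun i => (δ i : k i)) • (normalizedPacket p k : Set (PacketAlgebra p k)) ⊆
      (integerPacket p k : Set (PacketAlgebra p k)) := by
    rintro _ ⟨x, hx, rfl⟩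
    exact purePacket_mul_mem_integerPacket p k star δ (fun i hi => by rw [hδne i hi]; exact hg i) hδstar hx
  have hmono := packetLogμ_mono p k (packetAdm_smul_normalizedPacket p k _ (dEquiv_purePacket_ne_zero p k hδ0))
    (packetAdm_integerPacket p k) hsub
  -- the volume of the translate
  have hvol := packetLogVolume_ppow_mul_purePacket_smul p k (DFac p k) (dEquiv p k) 0 (fun i => (δ i : k i)) hδ0
  have h1 : ppow p k 0 = 1 := by rw [ppow, zpow_zero, map_one]
  rw [h1, one_mul, Int.cast_zero, zero_mul, neg_zero, zero_add] at hvol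
  have hlog : ∀ i, Real.log ‖(δ i : k i)‖ = if i = star then 0 else -(differentOrd p (k i) * Real.log p) := by
    intro i
    by_cases hi : i = star
    · subst hi; rw [if_pos rfl, hδstar, OneMemClass.coe_one, norm_one, Real.log_one]
    · rw [if_neg hi, hδne i hi, norm_eq_rpow_neg_differentOrd p (k i) (hg i) (hg0 i), Real.log_rpow hp0]
      ring
  have hsum : ∑ i, Real.log ‖(δ i : k i)‖ = -((dSum p k - differentOrd p (k star)) * Real.log p) := by
    simp_rw [hlog]
    rw [Finset.sum_ite, Finset.sum_const_zero, zero_add, dSum, Finset.sum_neg_distrib, ← Finset.sum_mul,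
      Finset.filter_ne' Finset.univ star, Finset.sum_erase_eq_sub (Finset.mem_univ star)]
  have hvol' : packetLogμ p k (purePacket p k (fun i => (δ i : k i)) •
      (normalizedPacket p k : Set (PacketAlgebra p k))) = -((dSum p k - differentOrd p (k star)) * Real.log p) := by
    rw [← hsum]; exact hvol
  rw [← hvol']
  exact hmono

/-! ## Tame packets: `log_p(R_I^×) = (⊗π_i)·R_I` -/

section Tame

variable (hp : 2 < p) (he : ∀ i, absRamificationIdx p (k i) ≤ p - 2)
include hp he

omit [Fintype I] [DecidableEq I] [Nonempty I] in
/-- Tame: the chosen uniformizers `π_i` realise `p^{−b_I}` (`‖π_i‖ = p^{−1/e_i} = p^{b_i}`, as `b_i = −1/e_i`).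
[cite: Mochizuki2012, IUTchIV Prop. 1.2 (i) p. 10] -/
theorem realizesNegB_unifChoice_of_tame : RealizesNegB p k (fun i => (unifChoice (k i) : k i)) := fun i => by
  rw [norm_eq_rpow_of_isUniformizer p (k i) (isUniformizer_unifChoice (k i)),
    logRadiusB_eq hp (absRamificationIdx_pos p (k i)) (he i)]

omit [Fintype I] [DecidableEq I] [Nonempty I] in
/-- Tame: `‖π_i‖ ≤ p^{−a_i}` (indeed `=`, as `a_i = 1/e_i`). [cite: Mochizuki2012, IUTchIV Prop. 1.2 (i) p. 10] -/
theorem norm_unifChoice_le_rpow_neg_logRadiusA_of_tame (i : I) :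
    ‖(unifChoice (k i) : k i)‖ ≤ (p : ℝ) ^ (-logRadiusA p (absRamificationIdx p (k i))) := by
  rw [norm_eq_rpow_of_isUniformizer p (k i) (isUniformizer_unifChoice (k i)),
    logRadiusA_eq hp (absRamificationIdx_pos p (k i)) (he i)]

omit [Fintype I] [DecidableEq I] [Nonempty I] in
/-- **Tame: `log_p(R_I^×) = (⊗_i π_i)·R_I`** as subsets of `V` (`⊆`: [IUTchIV] p. 11 fourth inclusion with `h = π`;
`⊇`: third inclusion with `α = π`; both abc-iut-S6's transports of Prop. 1.2 (i)). [cite: Mochizuki2012, IUTchIV Prop. 1.2 (i) p. 10] -/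
theorem coe_logPacket_eq_purePacket_smul_integerPacket_of_tame :
    (logPacket p k : Set (PacketAlgebra p k)) =
      purePacket p k (fun i => (unifChoice (k i) : k i)) • (integerPacket p k : Set (PacketAlgebra p k)) := by
  refine Set.Subset.antisymm (fun w hw => ?_) ?_
  · obtain ⟨y, hy, rfl⟩ :=
      exists_mem_integerPacket_of_mem_logPacket p k (realizesNegB_unifChoice_of_tame p k hp he) hw
    exact ⟨y, hy, rfl⟩
  · rintro _ ⟨r, hr, rfl⟩
    exact purePacket_mul_mem_logPacket p k (norm_unifChoice_le_rpow_neg_logRadiusA_of_tame p k hp he) hr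

/-- **Tame: `log μ̄(log_p(R_I^×)) = b_I·log p + log μ̄(R_I)`.** [cite: Mochizuki2012, IUTchIV Prop. 1.2 (i) p. 10]
[cite: DupuyHilado2025, §3.7] -/
theorem packetLogμ_logPacket_eq_of_tame :
    packetLogμ p k (logPacket p k : Set (PacketAlgebra p k)) =
      bSum p k * Real.log p + packetLogμ p k (integerPacket p k : Set (PacketAlgebra p k)) := by
  have hh := realizesNegB_unifChoice_of_tame p k hp he
  rw [coe_logPacket_eq_purePacket_smul_integerPacket_of_tame p k hp he,
    packetLogμ_smul p k _ (dEquiv_purePacket_ne_zero p k (ne_zero_of_realizesNegB p k hh))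
      (packetAdm_integerPacket p k),
    packetLogμ_purePacket_smul_normalizedPacket_of_realizesNegB p k hh]

/-- **Tame: the hull defect of the log-shell lattice is the normalisation defect of `R_I`**:
`δ_Λ = log μ̄(hull(log_p(R_I^×))) − log μ̄(log_p(R_I^×)) = −log μ̄(R_I)`. [cite: DupuyHilado2025, §4.12]
[cite: Mochizuki2012, IUTchIV Prop. 1.1 p. 9, Prop. 1.2 (i) p. 10] -/
theorem packetLogμ_packetHull_logPacket_sub_eq_of_tame :
    packetLogμ p k (packetHull p k (logPacket p k : Set (PacketAlgebra p k))) -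
        packetLogμ p k (logPacket p k : Set (PacketAlgebra p k)) =
      -packetLogμ p k (integerPacket p k : Set (PacketAlgebra p k)) := by
  rw [packetLogμ_packetHull_logPacket_eq_bSum_of_tame p k hp he, packetLogμ_logPacket_eq_of_tame p k hp he]
  ring

/-- Tame: `0 ≤ δ_Λ = −log μ̄(R_I) ≤ (d_I − d_*)·log p` for every slot `*`. [cite: Mochizuki2012, IUTchIV Prop. 1.1 p. 9] -/
theorem packetLogμ_packetHull_logPacket_sub_mem_Icc_of_tame (star : I) :
    0 ≤ packetLogμ p k (packetHull p k (logPacket p k : Set (PacketAlgebra p k))) -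
        packetLogμ p k (logPacket p k : Set (PacketAlgebra p k)) ∧
      packetLogμ p k (packetHull p k (logPacket p k : Set (PacketAlgebra p k))) -
          packetLogμ p k (logPacket p k : Set (PacketAlgebra p k)) ≤
        (dSum p k - differentOrd p (k star)) * Real.log p := by
  rw [packetLogμ_packetHull_logPacket_sub_eq_of_tame p k hp he]
  exact ⟨by linarith [packetLogμ_integerPacket_nonpos p k], by linarith [packetLogμ_integerPacket_ge p k star]⟩

/-- **Tame, exact**: the hull of the (Ind2)-orbit of a bounded region `M ⊄ {0}` of content `m` has
`log μ̄ = −m·log p + b_I·log p`. [cite: DupuyHilado2025, §4.9, §4.12] [cite: Mochizuki2012, IUTchIV Prop. 1.2 (i) p. 10] -/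
theorem exists_packetLogμ_packetHull_orbit_eq_of_tame {M : Set (PacketAlgebra p k)} (hMb : IsPsiBounded p k M)
    (hM0 : ∃ x ∈ M, x ≠ 0) :
    ∃ m : ℤ, M ⊆ ((p : ℚ_[p]) ^ m) • (logPacket p k : Set (PacketAlgebra p k)) ∧
      ¬ M ⊆ ((p : ℚ_[p]) ^ (m + 1)) • (logPacket p k : Set (PacketAlgebra p k)) ∧
      packetLogμ p k (packetHull p k (⋃ γ : indTwo p k, γ • M)) = -(m * Real.log p) + bSum p k * Real.log p := by
  obtain ⟨m, hm, hm1, -, hvol⟩ := exists_packetLogμ_packetHull_orbit_eq p k hMb hM0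
  refine ⟨m, hm, hm1, ?_⟩
  rw [hvol, packetLogμ_packetHull_logPacket_eq_bSum_of_tame p k hp he]

/-- **The tame volume-form window**: for a bounded region `M` with `ι_{i₁}(g_{i₁})·(R_I)^∼ ⊆ M ⊆ ⋃_i ι_i(g_i)·(R_I)^∼`
(`‖g_i‖ = p^{−m_i/e_i}`, `i₀` of least order) at a tame packet with `|I| ≥ 2`:
`log‖g_{i₁}‖ − log μ̄(R_I) ≤ log μ̄(hull(⋃_γ γ·M)) ≤ log‖g_{i₀}‖ − log μ̄(R_I) + {d_I + 1}·log p`.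
[cite: Mochizuki2012, IUTchIV Prop. 1.4 (iii) p. 13] [cite: DupuyHilado2025, §4.9, §4.12] -/
theorem packetLogμ_packetHull_orbit_window_of_tame (hI : 2 ≤ Fintype.card I) {M : Set (PacketAlgebra p k)}
    (hMb : IsPsiBounded p k M)
    (g : Π i, k i) (mexp : I → ℤ) (hg : ∀ i, ‖g i‖ = (p : ℝ) ^ (-((mexp i : ℝ) / absRamificationIdx p (k i))))
    (i₀ : I) (hmin : ∀ i, (mexp i₀ : ℝ) / absRamificationIdx p (k i₀) ≤ (mexp i : ℝ) / absRamificationIdx p (k i))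
    (hMU : M ⊆ ⋃ i, iota p k i (g i) • (normalizedPacket p k : Set (PacketAlgebra p k)))
    (i₁ : I) (hgM : iota p k i₁ (g i₁) • (normalizedPacket p k : Set (PacketAlgebra p k)) ⊆ M) :
    Real.log ‖g i₁‖ - packetLogμ p k (integerPacket p k : Set (PacketAlgebra p k)) ≤
        packetLogμ p k (packetHull p k (⋃ γ : indTwo p k, γ • M)) ∧
      packetLogμ p k (packetHull p k (⋃ γ : indTwo p k, γ • M)) ≤
        Real.log ‖g i₀‖ - packetLogμ p k (integerPacket p k : Set (PacketAlgebra p k)) +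
          (dSum p k + 1) * Real.log p := by
  have hg1 := slot_ne_zero_and_log_norm p k (hg i₁)
  have hM0 : ∃ x ∈ M, x ≠ 0 := by
    refine ⟨iota p k i₁ (g i₁), hgM ⟨1, Subring.one_mem _, ?_⟩, (map_ne_zero (iota p k i₁)).mpr hg1.1⟩
    change iota p k i₁ (g i₁) * 1 = iota p k i₁ (g i₁)
    rw [mul_one]
  have hδ := packetLogμ_packetHull_logPacket_sub_eq_of_tame p k hp he
  have hlo := packetLogμ_packetHull_orbit_ge_defect p k hMb hg1.1 hgM
  have hup := packetLogμ_packetHull_orbit_le_first' p k hI ∅ (fun i _ => he i) hMb hM0 g mexp hg i₀ hmin hMU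
  rw [Finset.card_empty, Nat.cast_zero, mul_zero, zero_div, add_zero] at hup
  rw [hδ] at hlo hup
  exact ⟨by linarith, by linarith⟩

end Tame

end Literature.IUT.LogVolume

end
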